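import Summits.QuantumFields.YangMills.Theorems.UnitScaleTiltProp7SPrintThm2Dict
import HarnessLib

/-!
# Route `UnitScaleTilt`, crux K1 child «MinimiserStabilityRegPr» (stmt-QuantumFields-19200), skeleton v10 stub EX (`stub_existenceMinimalOrbit`),
# route (α) of record `{C-min, COV}` (OWNER RULING g25-№1 §B) — **THE COV SOCKET: the criticality-free chart hypothesis COV of
# `Prop7ExistRouteAlphaMin.existenceMinimalOrbit_of_Cmin_cov` FROM [Balaban1985RegularSpaces] THEOREM 2 FOR THE BASED LETTERS ALONE**
# (= the `hT2` socket of `Prop7SPrintCond135.prop2Printed_sPrint_of_thm2` minus its last step, the criticality transport of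
# [Balaban1985Variational] Prop. 2), and hence FROM THE TREE'S THEOREM-2 INTERFACES `B8Thm2SetupTorus.Thm2SetupSUAt` ∕ `B8Thm2TorusAt.Thm2TorusAt`
# ∕ `B8Thm2TorusAt.Thm2TorusUniform` at `G = SU(2)`, regularity rider dropped, BY NAME

Cell `ym3-torus` ∕ width seat `ym-ust-19200-w1` (gen 2; D-0149; HUMAN RULING D-0037 — YM₃ on T³ is ladder rung R3, not the Clay problem).

WHY.  Route (α) into the stub EX is `existenceMinimalOrbit_of_Cmin_cov : C-min → COV → EX` (w2, p593620), criticality-free: COV asks, for every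
member (`F.L = L`, `n < K`, `k = K − n`), every `U₀ ∈ 𝔘_k(L³B₃ε₁)` with `|Ū₀ − V| < L³ε₁` and every `U` in print's regular fibre (6)(ε₀) of `V` in
the based axial gauge (1.19) relative to `U₀`, for a based-(1.29)-restricted gauge transformation `u`, a perturbation `U₁` and an exponent `X` with
`(U₁U₀)^u = U`, (19) at `ε₂ ≥ B₁(ε₀ + L³ε₁)`, (20) and (21) — print p. 280–281 «Configurations U from the space (18), and U₀, satisfy the assumptions
(1.33)–(1.35) of this theorem with α₀ = ε₀, α₁ = C₁ε₁ … there exists exactly one gauge transformation u … such that U₁ = U′^{u⁻¹} satisfies the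
conditions (1.36)–(1.39) of [6] … U₁ satisfying the conditions (19)–(21) with ε₂ ≧ B₁(ε₀ + C₁ε₁)» WITHOUT the sentence on critical configurations.
The w1 lineage's `prop2Printed_sPrint_of_thm2Based` ∕ `prop2Printed_sPrint_of_thm2` (p584429 ∕ p585942) prove exactly this paragraph PLUS the
criticality transport; this file re-runs the same chain without the last step, so that COV — and with it EX modulo C-min — hangs BY NAME on the
tree's [6]-Theorem-2 interfaces: the based-letters row (T2) (`cov_of_thm2`), `Thm2SetupSUAt … (fun _ => True)` at `x₀`-translates
(`cov_of_thm2SetupSUAt`, through `Prop7SPrintThm2Dict.thm2Based_of_thm2SetupSUAt`), the periodic-`ℤᵈ` consumer interface of the lit-balaban supplier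
`B8Thm2TorusSupplier` ∕ seat t2s-1 (`cov_of_thm2TorusAt`, through `B8Thm2SetupTorus.thm2SetupSUAt_of_thm2TorusAt` at `G = specialUnitaryUnits (Fin 2)`,
period `sitesPerDir 0`), and print's quantifier order (`cov_of_thm2TorusUniform`, one triple `(B₁, B₂(β₀), c₁)` for all `k ≥ 1`, `P`, `η`).

WHAT IS PROVED (sorry-free, no definition).  §1 **`cov_of_thm2Based`** (rows (T2) + (C135) ⟹ COV with `B₁′ = B₁M`, `c₁′ = min{c₁/M, e/(1+B₃), 1/(B₁M)}`,
`M = (1+C)(1+B₃)+1`) and **`cov_of_thm2`** ((T2) alone ⟹ COV; (C135) by `Prop7SPrintCond135.cond135_based_of_sat14_mem`, `C = C_L`, `e = (10⁸L³)⁻¹`);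
§2 **`cov_of_thm2SetupSUAt`**; §3 **`cov_of_thm2TorusAt`**, **`cov_of_thm2TorusUniform`**.  The conclusion is, token for token, the hypothesis `hV` of
`Prop7ExistRouteAlphaMin.existenceMinimalOrbit_of_Cmin_cov` (the composition `EX ⇐ C-min ∧ [6] Thm 2` is the sibling file `…Prop7ExistOfCminThm2`).

HONEST SCOPE.  REDUCTIONS only: [6] Theorem 2 at a curved background is NOT proved here or anywhere in the tree — the interfaces `Thm2SetupSUAt` ∕
`Thm2TorusAt` ∕ `Thm2TorusUniform` are hypothesis SHAPES (the lit-balaban supplier `B8Thm2TorusSupplier.thm2TorusAt_specialUnitary_of_sockets` is a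
theorem MODULO SOCKETS: Prop. 5, the in-edge (1.59) = [B9] Thm 3.3, the (1.42) clause); C-min, the stub EX, the crux and the mass gap are NOT claimed;
print's `α₀ = ε₀` is replaced by `ε₀ + L³B₃ε₁` (GAPS G-B11-A4) and `α₁ = C₁ε₁` by `C₁ε₁ + C(ε₀ + L³B₃ε₁)` (the two-averaging seam of CARD-19200-V3-g8
§1(c)), exactly as in `prop2Printed_sPrint_of_thm2Based`.  Count-neutral helper toward stmt-QuantumFields-19200 (`--supports`); nothing continuum ∕
OS ∕ mass-gap ∕ Clay.

References: T. Bałaban, CMP **102** (1985) 277–309 [Balaban1985Variational] ((14)–(18) p.280, (19)–(21) and Prop. 2 p.281, Prop. 7 p.299); CMP **99**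
(1985) 75–102 [Balaban1985RegularSpaces] ((1.19) p.79, (1.29) p.81, (1.33)–(1.38) p.82, (1.39) and Thm 2 p.83, p.77 («Ω_j = T_η for j = 0,1,…,l, l ≤ k»));
CMP **98** (1985) 17–51 [Balaban1985Averaging] ((24) p.21, (43) p.24, Prop. 1 (51) p.26).
-/

noncomputable section

namespace Summit.QuantumFields.YangMills.Theorems.Prop7CovOfThm2

open scoped Matrix.Norms.L2Operator
open NormedSpace
open Literature.MathematicalPhysics.QuantumFieldTheory.Balaban1983to89
open Literature.MathematicalPhysics.QuantumFieldTheory.Balaban1983to89.T3ContinuumYM3Torus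
open Literature.MathematicalPhysics.QuantumFieldTheory.Balaban1983to89.T3UnitLawDensityEML (ℰp)
open Literature.MathematicalPhysics.QuantumFieldTheory.Balaban1983to89.T3PrintedRegularMinimiser (RegPr regFibrePr mem_regFibrePr_iff)
open Literature.MathematicalPhysics.QuantumFieldTheory.Balaban1983to89.T3PrintedMinimiserExistence (regPr_mono)
open Literature.MathematicalPhysics.QuantumFieldTheory.Balaban1983to89.T3ConstrainedMinimiser (fibre)
open B7Prop1Explicit renaming Site → LSite
open B7Prop2SpecialUnitary (specialUnitaryUnits)
open B8Eq138LandauZd (IsLandau138)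
open B8Thm4TorusAt (torusLam)
open B8Thm2TorusAt (C136T C139T Cond135T Thm2TorusAt Thm2TorusUniform)
open B8Thm2SetupTorus (Thm2SetupSUAt thm2SetupSUAt_of_thm2TorusAt)
open B10Eq27TorusAxialLog (pull unitsField toUField)
open T3Thm1Carrier
open T3SectALandauChart (pert emb15 eta eta_pos bgUnits In19 CloseAvg)
open Summit.QuantumFields.YangMills.Theorems.Prop7SPrint (basePt IsAxialPrint RestrictedPrint AvgCondPrint IsLandauPrint)
open Summit.QuantumFields.YangMills.Theorems.Prop7SPrintIn19 (in19_of_based136_139)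
open Summit.QuantumFields.YangMills.Theorems.Prop7SPrintCond135 (cond135_based_of_sat14_mem)
open Summit.QuantumFields.YangMills.Theorems.Prop7SPrintThm2Dict (thm2Based_of_thm2SetupSUAt)

variable {L : ℕ}

/-! ## §1 COV from [6] Theorem 2 for the based letters (rows (T2) and (C135)) -/

/-- **COV FROM ROWS (T2) + (C135).**  For a block size `L`, constants `B₃ ≥ 0` ((162)), `B₁, c₁ > 0` ([6] Thm 2's), `C ≥ 0`, `e > 0` (row C135's):
(T2) the existence half of [6] Theorem 2 for print's based letters at the T³ carrier, (3.35)-free (the shape of `B8Thm2SetupTorus.Thm2SetupSUAt`'s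
conclusion read at `x₀ = basePt F n K`; verbatim the `hT2` of `Prop7SPrintCond135.prop2Printed_sPrint_of_thm2`) and (C135) its hypothesis (1.35)
from (14) + (18) IMPLY COV — the hypothesis `hV` of `Prop7ExistRouteAlphaMin.existenceMinimalOrbit_of_Cmin_cov` — with `B₁′ = B₁M`,
`c₁′ = min{c₁/M, e/(1+B₃), 1/(B₁M)}`, `M = (1 + C)(1 + B₃) + 1`: for every member, `0 < ε₀, ε₁`, `ε₀ + L³ε₁ ≤ c₁′`, `B₁′(ε₀ + L³ε₁) ≤ ε₂`,
`U₀ ∈ 𝔘_k(L³B₃ε₁)` with `|Ū₀ − V| < L³ε₁`, `U ∈ (6)(ε₀)` of `V` in the based axial gauge (1.19): `∃ u U₁ X`, (1.29)-restricted `u`,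
`(U₁U₀)^u = U`, (19) `In19 … ε₂`, (20) `AvgCondPrint`, (21) `IsLandauPrint` — print's Prop. 2 paragraph WITHOUT the criticality sentence
(`α₀ = ε₀ + L³B₃ε₁`, `α₁ = L³ε₁ + C·α₀`).
[cite: Balaban1985Variational, Prop. 2 p.281, (14)-(18) p.280, (19)-(21) p.281; Balaban1985RegularSpaces, Thm 2 p.83, (1.33)-(1.38) p.82, (1.39) p.83] -/
theorem cov_of_thm2Based {B₃ B₁ c₁ C e : ℝ} (hB₃ : 0 ≤ B₃) (hB₁ : 0 < B₁) (hc₁ : 0 < c₁) (hC : 0 ≤ C) (he : 0 < e)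
    (hT2 : ∀ (F : T3Family), F.L = L → ∀ (n K : ℕ), n < K → ∀ (α₀ α₁ : ℝ), 0 < α₀ → 0 < α₁ → α₀ + α₁ ≤ c₁ →
      ∀ (U₀ U : GaugeField (F.P K) 0 (Matrix.specialUnitaryGroup (Fin 2) ℂ)),
        RegPr F n K α₀ U₀ → RegPr F n K α₀ U → IsAxialPrint F n K U₀ U →
        Cond135T (F.P K).L (K - n) (pull (bgUnits F K U₀) (basePt F n K)) (pull (bgUnits F K (pert U₀ U)) (basePt F n K)) α₁ →
        ∃ (u : GaugeTransf (F.P K) 0 (Matrix.specialUnitaryGroup (Fin 2) ℂ))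
          (U₁ : GaugeField (F.P K) 0 (Matrix.specialUnitaryGroup (Fin 2) ℂ)) (A : PBond (F.P K) 0 → Matrix (Fin 2) (Fin 2) ℂ),
          RestrictedPrint F n K U₀ u ∧ GaugeField.gaugeAct u (emb15 U₀ U₁) = U ∧ (∀ b : PBond (F.P K) 0, IsSelfAdjoint (A b)) ∧
          (∀ b : PBond (F.P K) 0,
            ((U₁ b : Matrix.specialUnitaryGroup (Fin 2) ℂ) : Matrix (Fin 2) (Fin 2) ℂ) = exp (Complex.I • ((eta F n K) • A b))) ∧
          (∃ (β₀ B₂ : ℝ) (len : LSite (F.P K).d → ℝ),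
            C136T (F.P K).L (K - n) (eta F n K) β₀ B₁ B₂ len (α₀ + α₁) (pull (bgUnits F K U₀) (basePt F n K)) (pull A (basePt F n K))) ∧
          IsLandau138 (F.P K).L (K - n) (eta F n K) (Set.univ : Set (LSite (F.P K).d)) (torusLam (K - n))
            (pull (bgUnits F K U₀) (basePt F n K)) (pull A (basePt F n K)) ∧
          C139T (F.P K).L (K - n) (eta F n K) B₁ (α₀ + α₁) (pull (bgUnits F K U₀) (basePt F n K)) (pull A (basePt F n K)))
    (h135 : ∀ (F : T3Family), F.L = L → ∀ (n K : ℕ) (hnK : n < K) (ε₀ a b : ℝ)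
      (V : GaugeField (F.P n) 0 (Matrix.specialUnitaryGroup (Fin 2) ℂ)) (U₀ U : GaugeField (F.P K) 0 (Matrix.specialUnitaryGroup (Fin 2) ℂ)),
        RegPr F n K a U₀ → CloseAvg F n K hnK.le b V U₀ → U ∈ regFibrePr F n K hnK.le ε₀ V → ε₀ ≤ e → a ≤ e →
        Cond135T (F.P K).L (K - n) (pull (bgUnits F K U₀) (basePt F n K)) (pull (bgUnits F K (pert U₀ U)) (basePt F n K)) (b + C * (ε₀ + a))) :
    ∃ B₁' c₁' : ℝ, 0 < B₁' ∧ 0 < c₁' ∧ ∀ (F : T3Family) (hF : F.L = L) (n K : ℕ) (hnK : n < K) (ε₀ ε₁ ε₂ : ℝ), 0 < ε₀ → 0 < ε₁ →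
        ε₀ + (L : ℝ) ^ 3 * ε₁ ≤ c₁' → B₁' * (ε₀ + (L : ℝ) ^ 3 * ε₁) ≤ ε₂ →
        ∀ (V : GaugeField (F.P n) 0 (Matrix.specialUnitaryGroup (Fin 2) ℂ)) (U₀ : GaugeField (F.P K) 0 (Matrix.specialUnitaryGroup (Fin 2) ℂ)),
          RegPr F n K ((L : ℝ) ^ 3 * B₃ * ε₁) U₀ → CloseAvg F n K hnK.le ((L : ℝ) ^ 3 * ε₁) V U₀ →
          ∀ U : GaugeField (F.P K) 0 (Matrix.specialUnitaryGroup (Fin 2) ℂ), U ∈ regFibrePr F n K hnK.le ε₀ V → IsAxialPrint F n K U₀ U →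
            ∃ (u : GaugeTransf (F.P K) 0 (Matrix.specialUnitaryGroup (Fin 2) ℂ)) (U₁ : GaugeField (F.P K) 0 (Matrix.specialUnitaryGroup (Fin 2) ℂ))
              (X : PBond (F.P K) 0 → Matrix (Fin 2) (Fin 2) ℂ),
              RestrictedPrint F n K U₀ u ∧ GaugeField.gaugeAct u (emb15 U₀ U₁) = U ∧ In19 F n K ε₂ U₀ U₁ X ∧
                AvgCondPrint F n K hnK.le V U₀ X ∧ IsLandauPrint F n K U₀ X := by
  -- the constants
  set M : ℝ := (1 + C) * (1 + B₃) + 1 with hM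
  have hM1 : 1 ≤ M := by
    have h0 : 0 ≤ (1 + C) * (1 + B₃) := by positivity
    linarith
  have hM0 : 0 < M := lt_of_lt_of_le one_pos hM1
  refine ⟨B₁ * M, min (c₁ / M) (min (e / (1 + B₃)) (1 / (B₁ * M))), by positivity,
    lt_min (by positivity) (lt_min (by positivity) (by positivity)), ?_⟩
  intro F hF n K hnK ε₀ ε₁ ε₂ hε₀ hε₁ hsum hε₂ V U₀ hreg₀ hclose U hU hax
  -- bookkeeping of the radii: `t = ε₀ + C₁ε₁`, `a = C₁B₃ε₁ ≤ B₃t`, `α₀ = ε₀ + a ≤ (1 + B₃)t`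
  set C₁ : ℝ := (L : ℝ) ^ 3 with hC₁
  set t : ℝ := ε₀ + C₁ * ε₁ with ht
  have hC₁0 : 0 ≤ C₁ := by positivity
  have hCε : 0 ≤ C₁ * ε₁ := by positivity
  have ht0 : 0 < t := by positivity
  have hε₀t : ε₀ ≤ t := by linarith
  have ha : C₁ * B₃ * ε₁ ≤ B₃ * t := by nlinarith
  have htc : t ≤ c₁ / M := hsum.trans (min_le_left _ _)
  have hte : t ≤ e / (1 + B₃) := hsum.trans ((min_le_right _ _).trans (min_le_left _ _))
  have htB : t ≤ 1 / (B₁ * M) := hsum.trans ((min_le_right _ _).trans (min_le_right _ _))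
  have htc' : M * t ≤ c₁ := by rw [le_div_iff₀ hM0] at htc; linarith
  have hte' : (1 + B₃) * t ≤ e := by rw [le_div_iff₀ (by positivity)] at hte; linarith
  have htB' : B₁ * M * t ≤ 1 := by rw [le_div_iff₀ (by positivity)] at htB; linarith
  -- `α₀`, `α₁`
  set α₀ : ℝ := ε₀ + C₁ * B₃ * ε₁ with hα₀
  set α₁ : ℝ := C₁ * ε₁ + C * (ε₀ + C₁ * B₃ * ε₁) with hα₁
  have hα₀pos : 0 < α₀ := by positivity
  have hα₁pos : 0 < α₁ := by
    have : 0 < C₁ * ε₁ := by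
      have hL : (0 : ℝ) < (L : ℝ) ^ 3 := by
        have := F.hL.2; rw [← hF]; positivity
      exact mul_pos hL hε₁
    positivity
  have hα₀le : α₀ ≤ (1 + B₃) * t := by nlinarith
  have hs : α₀ + α₁ ≤ M * t := by
    have h1 : (1 + C) * α₀ ≤ (1 + C) * ((1 + B₃) * t) := mul_le_mul_of_nonneg_left hα₀le (by positivity)
    have h2 : α₀ + α₁ = (1 + C) * α₀ + C₁ * ε₁ := by rw [hα₁]; ring
    rw [h2, hM]; nlinarith
  have hsc₁ : α₀ + α₁ ≤ c₁ := hs.trans htc'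
  have hs1 : B₁ * (α₀ + α₁) ≤ 1 := (mul_le_mul_of_nonneg_left hs hB₁.le).trans (by rw [← mul_assoc]; exact htB')
  have hsε₂ : B₁ * (α₀ + α₁) ≤ ε₂ := (mul_le_mul_of_nonneg_left hs hB₁.le).trans (by rw [← mul_assoc]; exact hε₂)
  -- the data in `𝔘_k(α₀)`
  obtain ⟨hUfib, hregU⟩ := (mem_regFibrePr_iff F).mp hU
  have hregU' : RegPr F n K α₀ U := regPr_mono F (by rw [hα₀]; nlinarith) hregU
  have hreg₀' : RegPr F n K α₀ U₀ := regPr_mono F (by rw [hα₀]; linarith) hreg₀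
  -- (1.35) from (14) + (18): row C135 with `a = C₁B₃ε₁`, `b = C₁ε₁`
  have hε₀e : ε₀ ≤ e := hε₀t.trans (le_trans (by nlinarith) hte')
  have hae : C₁ * B₃ * ε₁ ≤ e := ha.trans (le_trans (by nlinarith) hte')
  have h35 := h135 F hF n K hnK ε₀ (C₁ * B₃ * ε₁) (C₁ * ε₁) V U₀ U hreg₀ hclose hU hε₀e hae
  -- Theorem 2 for the based letters
  obtain ⟨u, U₁, A, hrestr, hgauge, hsa, hexp, ⟨β₀, B₂, len, h36⟩, h38, h39⟩ :=
    hT2 F hF n K hnK α₀ α₁ hα₀pos hα₁pos hsc₁ U₀ U hreg₀' hregU' hax h35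
  have hη : 0 < eta F n K := eta_pos F n K
  -- the exponent `X = ηA` of (19)
  refine ⟨u, U₁, fun b => (eta F n K) • A b, hrestr, hgauge, ?_, ?_, ?_⟩
  · -- (19)
    exact in19_of_based136_139 F (basePt F n K) hsa hexp h36 h39 hs1 hsε₂
  · -- (20): the configuration `U₁U₀` lies on `Σ_k`, carried by `u` to `U ∈ Ax_k ∩ 𝔅_k(V)`
    intro U₁' hU₁'
    have hU₁eq : U₁' = U₁ := by
      funext b
      exact Subtype.ext ((hU₁' b).trans (hexp b).symm)
    subst hU₁eq
    exact ⟨u, hrestr, by rw [hgauge]; exact hax, by rw [hgauge]; exact hUfib⟩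
  · -- (21) = (1.38) for `A = η⁻¹X`
    have hX : (fun b : PBond (F.P K) 0 => (eta F n K)⁻¹ • ((eta F n K) • A b)) = A :=
      funext fun b => inv_smul_smul₀ hη.ne' (A b)
    show IsLandau138 (F.P K).L (K - n) (eta F n K) (Set.univ : Set (LSite (F.P K).d)) (torusLam (K - n))
      (pull (unitsField (toUField U₀)) (basePt F n K)) (pull (fun b => (eta F n K)⁻¹ • ((eta F n K) • A b)) (basePt F n K))
    rw [hX]
    exact h38

/-- **COV FROM ROW (T2) ALONE** — [6] Theorem 2, existence half, for print's based letters at the T³ carrier (the `hT2` socket of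
`Prop7SPrintCond135.prop2Printed_sPrint_of_thm2`, verbatim) IMPLIES the criticality-free chart hypothesis COV of route (α)
(`Prop7ExistRouteAlphaMin.existenceMinimalOrbit_of_Cmin_cov`'s `hV`, verbatim), for every `B₃ ≥ 0`: row (C135) is the theorem
`Prop7SPrintCond135.cond135_based_of_sat14_mem` (`C = 2(14336 + (21/20)((5L)²/4)(10800L + 1))`, `e = (10⁸L³)⁻¹`); for `L ≤ 1` the family has no member.
[cite: Balaban1985Variational, Prop. 2 p.281, (14)-(18) p.280; Balaban1985RegularSpaces, Thm 2 p.83, (1.35) p.82; Balaban1985Averaging, Prop. 1 (51) p.26] -/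
theorem cov_of_thm2 {B₃ B₁ c₁ : ℝ} (hB₃ : 0 ≤ B₃) (hB₁ : 0 < B₁) (hc₁ : 0 < c₁)
    (hT2 : ∀ (F : T3Family), F.L = L → ∀ (n K : ℕ), n < K → ∀ (α₀ α₁ : ℝ), 0 < α₀ → 0 < α₁ → α₀ + α₁ ≤ c₁ →
      ∀ (U₀ U : GaugeField (F.P K) 0 (Matrix.specialUnitaryGroup (Fin 2) ℂ)),
        RegPr F n K α₀ U₀ → RegPr F n K α₀ U → IsAxialPrint F n K U₀ U →
        Cond135T (F.P K).L (K - n) (pull (bgUnits F K U₀) (basePt F n K)) (pull (bgUnits F K (pert U₀ U)) (basePt F n K)) α₁ →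
        ∃ (u : GaugeTransf (F.P K) 0 (Matrix.specialUnitaryGroup (Fin 2) ℂ))
          (U₁ : GaugeField (F.P K) 0 (Matrix.specialUnitaryGroup (Fin 2) ℂ)) (A : PBond (F.P K) 0 → Matrix (Fin 2) (Fin 2) ℂ),
          RestrictedPrint F n K U₀ u ∧ GaugeField.gaugeAct u (emb15 U₀ U₁) = U ∧ (∀ b : PBond (F.P K) 0, IsSelfAdjoint (A b)) ∧
          (∀ b : PBond (F.P K) 0,
            ((U₁ b : Matrix.specialUnitaryGroup (Fin 2) ℂ) : Matrix (Fin 2) (Fin 2) ℂ) = exp (Complex.I • ((eta F n K) • A b))) ∧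
          (∃ (β₀ B₂ : ℝ) (len : LSite (F.P K).d → ℝ),
            C136T (F.P K).L (K - n) (eta F n K) β₀ B₁ B₂ len (α₀ + α₁) (pull (bgUnits F K U₀) (basePt F n K)) (pull A (basePt F n K))) ∧
          IsLandau138 (F.P K).L (K - n) (eta F n K) (Set.univ : Set (LSite (F.P K).d)) (torusLam (K - n))
            (pull (bgUnits F K U₀) (basePt F n K)) (pull A (basePt F n K)) ∧
          C139T (F.P K).L (K - n) (eta F n K) B₁ (α₀ + α₁) (pull (bgUnits F K U₀) (basePt F n K)) (pull A (basePt F n K))) :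
    ∃ B₁' c₁' : ℝ, 0 < B₁' ∧ 0 < c₁' ∧ ∀ (F : T3Family) (hF : F.L = L) (n K : ℕ) (hnK : n < K) (ε₀ ε₁ ε₂ : ℝ), 0 < ε₀ → 0 < ε₁ →
        ε₀ + (L : ℝ) ^ 3 * ε₁ ≤ c₁' → B₁' * (ε₀ + (L : ℝ) ^ 3 * ε₁) ≤ ε₂ →
        ∀ (V : GaugeField (F.P n) 0 (Matrix.specialUnitaryGroup (Fin 2) ℂ)) (U₀ : GaugeField (F.P K) 0 (Matrix.specialUnitaryGroup (Fin 2) ℂ)),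
          RegPr F n K ((L : ℝ) ^ 3 * B₃ * ε₁) U₀ → CloseAvg F n K hnK.le ((L : ℝ) ^ 3 * ε₁) V U₀ →
          ∀ U : GaugeField (F.P K) 0 (Matrix.specialUnitaryGroup (Fin 2) ℂ), U ∈ regFibrePr F n K hnK.le ε₀ V → IsAxialPrint F n K U₀ U →
            ∃ (u : GaugeTransf (F.P K) 0 (Matrix.specialUnitaryGroup (Fin 2) ℂ)) (U₁ : GaugeField (F.P K) 0 (Matrix.specialUnitaryGroup (Fin 2) ℂ))
              (X : PBond (F.P K) 0 → Matrix (Fin 2) (Fin 2) ℂ),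
              RestrictedPrint F n K U₀ u ∧ GaugeField.gaugeAct u (emb15 U₀ U₁) = U ∧ In19 F n K ε₂ U₀ U₁ X ∧
                AvgCondPrint F n K hnK.le V U₀ X ∧ IsLandauPrint F n K U₀ X := by
  by_cases hL : 1 < L
  · have hL0 : (0 : ℝ) < L := by exact_mod_cast (lt_trans zero_lt_one hL)
    exact cov_of_thm2Based hB₃ hB₁ hc₁
      (C := 2 * (14336 + 21 / 20 * (((5 * (L : ℝ)) ^ 2 / 4) * (10800 * (L : ℝ) + 1)))) (e := (10 ^ 8 * (L : ℝ) ^ 3)⁻¹)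
      (by positivity) (by positivity) hT2
      (fun F hF n K hnK ε₀ a b V U₀ U hreg₀ hclose hU hε₀e hae => by
        have h := cond135_based_of_sat14_mem F hnK hreg₀ hclose hU (by rw [hF]; exact hε₀e) (by rw [hF]; exact hae)
        rwa [hF] at h)
  · -- no member of the family has block size `L ≤ 1`: COV is vacuous
    refine ⟨1, 1, one_pos, one_pos, ?_⟩
    intro F hF
    exact absurd (hF ▸ F.hL.2) hL

/-! ## §2 COV from the Setup-torus interface `Thm2SetupSUAt … (fun _ => True)` (OWNER RULING g23-№3 (c2)) -/

/-- **COV FROM `B8Thm2SetupTorus.Thm2SetupSUAt` BY NAME**: if for every member (`F.L = L`, `n < K`) [6] Theorem 2 holds at the Setup-torus objects for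
`SU(2)`, `k = K − n` levels, `η = L^{−k}`, constants `B₁, c₁` (any Hölder data `β₀, B₂, len`) and NO regularity rider (`Reg := fun _ => True`, print
p. 82 «eventually we will drop it out of the assumptions»), then COV holds for every `B₃ ≥ 0` (= `cov_of_thm2` ∘ `Prop7SPrintThm2Dict.thm2Based_of_thm2SetupSUAt`:
Theorem 2 at the `x₀`-translated pair, translated back).
[cite: Balaban1985RegularSpaces, Thm 2 p.83, (1.33)-(1.38) p.82; Balaban1985Variational, Prop. 2 p.281] -/
theorem cov_of_thm2SetupSUAt {B₃ B₁ c₁ : ℝ} (hB₃ : 0 ≤ B₃) (hB₁ : 0 < B₁) (hc₁ : 0 < c₁)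
    (hThm2 : ∀ (F : T3Family), F.L = L → ∀ (n K : ℕ), n < K →
      ∃ (β₀ B₂ : ℝ) (len : LSite (F.P K).d → ℝ), Thm2SetupSUAt (F.P K) 2 (K - n) (eta F n K) β₀ B₁ B₂ c₁ len (fun _ => True)) :
    ∃ B₁' c₁' : ℝ, 0 < B₁' ∧ 0 < c₁' ∧ ∀ (F : T3Family) (hF : F.L = L) (n K : ℕ) (hnK : n < K) (ε₀ ε₁ ε₂ : ℝ), 0 < ε₀ → 0 < ε₁ →
        ε₀ + (L : ℝ) ^ 3 * ε₁ ≤ c₁' → B₁' * (ε₀ + (L : ℝ) ^ 3 * ε₁) ≤ ε₂ →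
        ∀ (V : GaugeField (F.P n) 0 (Matrix.specialUnitaryGroup (Fin 2) ℂ)) (U₀ : GaugeField (F.P K) 0 (Matrix.specialUnitaryGroup (Fin 2) ℂ)),
          RegPr F n K ((L : ℝ) ^ 3 * B₃ * ε₁) U₀ → CloseAvg F n K hnK.le ((L : ℝ) ^ 3 * ε₁) V U₀ →
          ∀ U : GaugeField (F.P K) 0 (Matrix.specialUnitaryGroup (Fin 2) ℂ), U ∈ regFibrePr F n K hnK.le ε₀ V → IsAxialPrint F n K U₀ U →
            ∃ (u : GaugeTransf (F.P K) 0 (Matrix.specialUnitaryGroup (Fin 2) ℂ)) (U₁ : GaugeField (F.P K) 0 (Matrix.specialUnitaryGroup (Fin 2) ℂ))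
              (X : PBond (F.P K) 0 → Matrix (Fin 2) (Fin 2) ℂ),
              RestrictedPrint F n K U₀ u ∧ GaugeField.gaugeAct u (emb15 U₀ U₁) = U ∧ In19 F n K ε₂ U₀ U₁ X ∧
                AvgCondPrint F n K hnK.le V U₀ X ∧ IsLandauPrint F n K U₀ X :=
  cov_of_thm2 hB₃ hB₁ hc₁ fun F hF n K hnK α₀ α₁ hα₀ hα₁ hc U₀ U h₀ hU hax h35 => by
    obtain ⟨β₀, B₂, len, hT⟩ := hThm2 F hF n K hnK
    obtain ⟨u, U₁, A, h1, h2, h3, h4, h36, h38, h39⟩ := thm2Based_of_thm2SetupSUAt F hT hα₀ hα₁ hc U₀ U h₀ hU hax h35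
    exact ⟨u, U₁, A, h1, h2, h3, h4, ⟨β₀, B₂, len, h36⟩, h38, h39⟩

/-! ## §3 COV from the periodic-`ℤᵈ` interface `Thm2TorusAt` at `G = SU(2)` — the consumer interface of the lit-balaban supplier — and from print's
quantifier order `Thm2TorusUniform` -/

/-- **COV FROM `B8Thm2TorusAt.Thm2TorusAt` AT `G = specialUnitaryUnits (Fin 2)` BY NAME**: if for every member (`F.L = L`, `n < K`) [6] Theorem 2 holds
for `Ω_j = T_η` read as `sitesPerDir 0`-periodic data on `ℤ³`, `k = K − n` levels, spacing `η = L^{−k}`, gauge group `SU(2) ⊂ M₂(ℂ)`, constants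
`B₁, c₁` (any `β₀, B₂, len`) and NO regularity rider — the interface the lit-balaban supplier `B8Thm2TorusSupplier.thm2TorusAt_specialUnitary_of_sockets`
concludes (modulo its sockets) — then COV holds for every `B₃ ≥ 0` (through `B8Thm2SetupTorus.thm2SetupSUAt_of_thm2TorusAt` and §2).
[cite: Balaban1985RegularSpaces, Thm 2 p.83, p.77 («Ω_j = T_η for j = 0,1,…,l, l ≤ k»); Balaban1985Variational, Prop. 2 p.281] -/
theorem cov_of_thm2TorusAt {B₃ B₁ c₁ : ℝ} (hB₃ : 0 ≤ B₃) (hB₁ : 0 < B₁) (hc₁ : 0 < c₁)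
    (hThm2 : ∀ (F : T3Family), F.L = L → ∀ (n K : ℕ), n < K →
      ∃ (β₀ B₂ : ℝ) (len : LSite (F.P K).d → ℝ),
        Thm2TorusAt (F.P K).L (K - n) ((((F.P K).sitesPerDir 0 : ℕ) : ℤ)) (eta F n K) β₀ B₁ B₂ c₁ len
          (specialUnitaryUnits (Fin 2)) (fun _ => True)) :
    ∃ B₁' c₁' : ℝ, 0 < B₁' ∧ 0 < c₁' ∧ ∀ (F : T3Family) (hF : F.L = L) (n K : ℕ) (hnK : n < K) (ε₀ ε₁ ε₂ : ℝ), 0 < ε₀ → 0 < ε₁ →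
        ε₀ + (L : ℝ) ^ 3 * ε₁ ≤ c₁' → B₁' * (ε₀ + (L : ℝ) ^ 3 * ε₁) ≤ ε₂ →
        ∀ (V : GaugeField (F.P n) 0 (Matrix.specialUnitaryGroup (Fin 2) ℂ)) (U₀ : GaugeField (F.P K) 0 (Matrix.specialUnitaryGroup (Fin 2) ℂ)),
          RegPr F n K ((L : ℝ) ^ 3 * B₃ * ε₁) U₀ → CloseAvg F n K hnK.le ((L : ℝ) ^ 3 * ε₁) V U₀ →
          ∀ U : GaugeField (F.P K) 0 (Matrix.specialUnitaryGroup (Fin 2) ℂ), U ∈ regFibrePr F n K hnK.le ε₀ V → IsAxialPrint F n K U₀ U →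
            ∃ (u : GaugeTransf (F.P K) 0 (Matrix.specialUnitaryGroup (Fin 2) ℂ)) (U₁ : GaugeField (F.P K) 0 (Matrix.specialUnitaryGroup (Fin 2) ℂ))
              (X : PBond (F.P K) 0 → Matrix (Fin 2) (Fin 2) ℂ),
              RestrictedPrint F n K U₀ u ∧ GaugeField.gaugeAct u (emb15 U₀ U₁) = U ∧ In19 F n K ε₂ U₀ U₁ X ∧
                AvgCondPrint F n K hnK.le V U₀ X ∧ IsLandauPrint F n K U₀ X :=
  cov_of_thm2SetupSUAt hB₃ hB₁ hc₁ fun F hF n K hnK => by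
    obtain ⟨β₀, B₂, len, hT⟩ := hThm2 F hF n K hnK
    exact ⟨β₀, B₂, len, thm2SetupSUAt_of_thm2TorusAt hT⟩

/-- **COV FROM PRINT'S QUANTIFIER ORDER `B8Thm2TorusAt.Thm2TorusUniform` AT `d = 3`, `G = SU(2)`** («There exist constants B₁, B₂(β₀), c₁ such that
for arbitrary U₀, U′U₀ …»; one triple for every number of levels `k ≥ 1`, every period and every spacing `η > 0`, no regularity rider): then COV holds
for every `B₃ ≥ 0`, at every member with `k = K − n ≥ 1`, `η = L^{−k}`, period `sitesPerDir 0` (§3 with `B8Thm2TorusAt.thm2TorusAt_of_uniform`).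
[cite: Balaban1985RegularSpaces, Thm 2 p.83, p.83 (sentence after (1.39)); Balaban1985Variational, Prop. 2 p.281] -/
theorem cov_of_thm2TorusUniform {B₃ β₀ : ℝ} (hB₃ : 0 ≤ B₃) {len : LSite 3 → ℝ}
    (hU : Thm2TorusUniform (𝔸 := Matrix (Fin 2) (Fin 2) ℂ) L β₀ len (specialUnitaryUnits (Fin 2)) (fun _ _ _ _ => True)) :
    ∃ B₁' c₁' : ℝ, 0 < B₁' ∧ 0 < c₁' ∧ ∀ (F : T3Family) (hF : F.L = L) (n K : ℕ) (hnK : n < K) (ε₀ ε₁ ε₂ : ℝ), 0 < ε₀ → 0 < ε₁ →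
        ε₀ + (L : ℝ) ^ 3 * ε₁ ≤ c₁' → B₁' * (ε₀ + (L : ℝ) ^ 3 * ε₁) ≤ ε₂ →
        ∀ (V : GaugeField (F.P n) 0 (Matrix.specialUnitaryGroup (Fin 2) ℂ)) (U₀ : GaugeField (F.P K) 0 (Matrix.specialUnitaryGroup (Fin 2) ℂ)),
          RegPr F n K ((L : ℝ) ^ 3 * B₃ * ε₁) U₀ → CloseAvg F n K hnK.le ((L : ℝ) ^ 3 * ε₁) V U₀ →
          ∀ U : GaugeField (F.P K) 0 (Matrix.specialUnitaryGroup (Fin 2) ℂ), U ∈ regFibrePr F n K hnK.le ε₀ V → IsAxialPrint F n K U₀ U →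
            ∃ (u : GaugeTransf (F.P K) 0 (Matrix.specialUnitaryGroup (Fin 2) ℂ)) (U₁ : GaugeField (F.P K) 0 (Matrix.specialUnitaryGroup (Fin 2) ℂ))
              (X : PBond (F.P K) 0 → Matrix (Fin 2) (Fin 2) ℂ),
              RestrictedPrint F n K U₀ u ∧ GaugeField.gaugeAct u (emb15 U₀ U₁) = U ∧ In19 F n K ε₂ U₀ U₁ X ∧
                AvgCondPrint F n K hnK.le V U₀ X ∧ IsLandauPrint F n K U₀ X := by
  obtain ⟨B₁, B₂, c₁, hB₁, _hB₂, hc₁, H⟩ := hU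
  refine cov_of_thm2TorusAt hB₃ hB₁ hc₁ fun F hF n K hnK => ⟨β₀, B₂, len, ?_⟩
  have hk : 1 ≤ K - n := by omega
  subst hF
  exact H (K - n) ((((F.P K).sitesPerDir 0 : ℕ) : ℤ)) (eta F n K) hk (eta_pos F n K)

end Summit.QuantumFields.YangMills.Theorems.Prop7CovOfThm2

end
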